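import Summits.QuantumFields.BalabanUV.Beta.ResolventBoxCertificateTaylor
import Summits.QuantumFields.BalabanUV.Beta.GAN24.ArrowNorms

/-!
# Beta / ResolventBoxCertificateNorms — the NORM-CURRENCY ADAPTER of the box certificate: the engines' Frobenius (Hilbert–Schmidt) majorants
# are admissible for every Euclidean-operator-norm hypothesis (β sub-cell, BINDER-OWNERS row CAP-k, lineage `b2b-balaban-beta-an5`, gen 23;
# node BETA-an5-g23-THEOREM-DB, annex to the order-m socket; cap1-g10 l.15269 (3c): residuals and preconditioner sups are certified in `‖·‖_F`)

The kernel hypotheses of `ResolventBoxCertificate.krawczyk` ∕ `ResolventBoxCertificateTaylor.box_certificate_of_residual` ∕ `box_certificate_taylor`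
(`‖1 − P(q)·A(q)‖ ≤ θ`, `‖P(q)‖ ≤ p`) and of route A's `hBa` are in the Euclidean OPERATOR norm `‖·‖₂` (`Matrix.Norms.L2Operator`); the Taylor-model
engines (cap1 `tm.py`/`tmz.py`, cap3 L-CF) bound the FROBENIUS norm (or Schatten majorants of it) because it is phase-free and polynomial in the
entries.  `l2_opNorm_le_frobenius`: `‖M‖₂ ≤ (Σ_{ij} |M_{ij}|²)^{1/2}` (Cauchy–Schwarz row by row) — so a certified Frobenius bound IS a certified
hypothesis of every lemma above (`box_certificate_of_residual_frobenius`).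

HONEST FRAMING.  Kernel glue ([folklore] linear algebra); no number; 0 binders instantiated; NOT BetaPertH, NOT continuum, NOT Clay.  0 `sorry`, 0 cite tags.
-/

namespace Summit.QuantumFields.BalabanUV.Beta.ResolventBoxCertificate

open Complex Set Matrix Finset WithLp
open Summit.QuantumFields.BalabanUV.Beta.GAN24.ArrowNorms (l2_opNorm_le_of_forall norm_le_of_sq_le)
open scoped Real Matrix.Norms.L2Operator InnerProductSpace

noncomputable section

/-- THE FROBENIUS SUM of a matrix: `Σ_i Σ_j ‖M i j‖²`. [folklore] -/
def frobSq {m o : Type*} [Fintype m] [Fintype o] (M : Matrix m o ℂ) : ℝ := ∑ i, ∑ j, ‖M i j‖ ^ 2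

/-- it is non-negative. [folklore] -/
theorem frobSq_nonneg {m o : Type*} [Fintype m] [Fintype o] (M : Matrix m o ℂ) : 0 ≤ frobSq M :=
  Finset.sum_nonneg fun _ _ => Finset.sum_nonneg fun _ _ => sq_nonneg _

/-- **THE EUCLIDEAN OPERATOR NORM IS BOUNDED BY THE FROBENIUS NORM**: `‖M‖₂ ≤ √(Σ_{ij} ‖M_{ij}‖²)` (Cauchy–Schwarz in each row). [folklore] -/
theorem l2_opNorm_le_frobenius {m o : Type*} [Fintype m] [Fintype o] [DecidableEq o] (M : Matrix m o ℂ) :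
    ‖M‖ ≤ Real.sqrt (frobSq M) := by
  refine l2_opNorm_le_of_forall _ (Real.sqrt_nonneg _) fun x =>
    norm_le_of_sq_le _ (mul_nonneg (Real.sqrt_nonneg _) (norm_nonneg _)) ?_
  rw [mul_pow, Real.sq_sqrt (frobSq_nonneg M), EuclideanSpace.norm_sq_eq]
  have hx : ‖x‖ ^ 2 = ∑ j, ‖ofLp x j‖ ^ 2 := by rw [EuclideanSpace.norm_sq_eq]
  have hrow : ∀ i, ‖(toLp 2 (M *ᵥ ofLp x) : EuclideanSpace ℂ m) i‖ ^ 2 ≤ (∑ j, ‖M i j‖ ^ 2) * ∑ j, ‖ofLp x j‖ ^ 2 := by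
    intro i
    have e : (toLp 2 (M *ᵥ ofLp x) : EuclideanSpace ℂ m) i = ∑ j, M i j * ofLp x j := by
      simp only [Matrix.mulVec, dotProduct]
    rw [e]
    calc ‖∑ j, M i j * ofLp x j‖ ^ 2 ≤ (∑ j, ‖M i j‖ * ‖ofLp x j‖) ^ 2 := by
          gcongr; exact (norm_sum_le _ _).trans (le_of_eq (Finset.sum_congr rfl fun j _ => norm_mul _ _))
      _ ≤ (∑ j, ‖M i j‖ ^ 2) * ∑ j, ‖ofLp x j‖ ^ 2 := Finset.sum_mul_sq_le_sq_mul_sq _ _ _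
  calc ∑ i, ‖(toLp 2 (M *ᵥ ofLp x) : EuclideanSpace ℂ m) i‖ ^ 2
      ≤ ∑ i, (∑ j, ‖M i j‖ ^ 2) * ∑ j, ‖ofLp x j‖ ^ 2 := Finset.sum_le_sum fun i _ => hrow i
    _ = frobSq M * ‖x‖ ^ 2 := by rw [frobSq, Finset.sum_mul, hx]

/-- a certified Frobenius bound is a certified operator-norm bound. [folklore] -/
theorem l2_opNorm_le_of_frobSq_le {m o : Type*} [Fintype m] [Fintype o] [DecidableEq o] (M : Matrix m o ℂ) {t : ℝ} (ht : 0 ≤ t)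
    (h : frobSq M ≤ t ^ 2) : ‖M‖ ≤ t :=
  (l2_opNorm_le_frobenius M).trans ((Real.sqrt_le_sqrt h).trans_eq (Real.sqrt_sq ht))

variable {d : ℕ} {n : Type*} [Fintype n] [DecidableEq n]

/-- **THE RESIDUAL SOCKET IN FROBENIUS CURRENCY**: the engines' certified bounds `Σ_{ij}|(1 − P(q)A(q))_{ij}|² ≤ θ²` and `Σ_{ij}|P(q)_{ij}|² ≤ p²` on
the box (phase-free, polynomial in the entries — what a Taylor-model engine produces) ⟹ `IsUnit (A q).det ∧ ‖(A q)⁻¹‖₂ ≤ B` on the box for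
`θ < 1`, `B ≥ p/(1−θ)`. [folklore] -/
theorem box_certificate_of_residual_frobenius {A P : (Fin (d + 1) → ℂ) → Matrix n n ℂ} {c : Fin (d + 1) → ℂ} {h : Fin (d + 1) → ℝ}
    {θ p B : ℝ} (hθ0 : 0 ≤ θ) (hp0 : 0 ≤ p) (hres : ∀ q ∈ Box c h, frobSq (1 - P q * A q) ≤ θ ^ 2) (hθ1 : θ < 1)
    (hP : ∀ q ∈ Box c h, frobSq (P q) ≤ p ^ 2) (hB : p / (1 - θ) ≤ B) :
    ∀ q ∈ Box c h, IsUnit (A q).det ∧ ‖(A q)⁻¹‖ ≤ B :=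
  box_certificate_of_residual (fun q hq => l2_opNorm_le_of_frobSq_le _ hθ0 (hres q hq)) hθ1
    (fun q hq => l2_opNorm_le_of_frobSq_le _ hp0 (hP q hq)) hB

end

end Summit.QuantumFields.BalabanUV.Beta.ResolventBoxCertificate
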